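import Mathlib
import Literature.NumberTheory.EllipticCurves.ModularSymbolRep
import Literature.NumberTheory.Automorphic.ZhouLegendreGreenValues
import Literature.NumberTheory.Automorphic.InvariantLaplacian
import Literature.NumberTheory.Automorphic.HigherGreenFunctionCM
import Literature.NumberTheory.Automorphic.HigherGreenFunctionCMProofs
import Literature.NumberTheory.Automorphic.HigherGreenFunctionProofs
import Literature.NumberTheory.Automorphic.GreenRhoEichlerIntegral
import HarnessLib

/-!
# Weight-4 Eichler integrals for Hecke triangle groups: the generic Green-function construction

[topic NumberTheory/Automorphic]

Support file for `Literature.NumberTheory.Automorphic.Zhou2015_legendreP_sq_integral`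
(Zhou 2015, Remark 9, levels `2` and `3`). The level-one construction of
`GreenRhoEichlerIntegral.lean` (the Green function `G₂(·, ρ)` of `PSL₂(ℤ)` as the Eichler integral
of `Δ/E₄²`) is run here once and for all for an abstract **Hecke-type datum**
`D : HeckeFormData`: a function `g : ℍ → ℂ` which is holomorphic above the height `a ∈ (0,1)`,
`per`-periodic (`0 < per ≤ 2`), of weight `4` under `S : τ ↦ −1/τ` (`g(−1/τ) = τ⁴ g(τ)`) and
tends to `0` at `i∞`. The groups `Γ₀(N)⁺ = ⟨Γ₀(N), W_N⟩`, `N = 2, 3`, become the Hecke triangle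
groups `⟨S, T^{√N}⟩` in the coordinate `v = √N z`, with `W_N ↦ S`; the weight-4 forms
`Δ₂/𝓔²` (level 2) and `Δ₃/𝓔₃` (level 3) with double poles on the orbit of the corner of the
fundamental domain give such data with `a = Im(corner)·√N`, `per = √N`.

## Contents (all sorry-free; `D : HeckeFormData` throughout)

* §1 the shifted cusp function `φ = g(· + ia)` (`isCuspFunction_φ`), moments
  `M_j(w) = ∫_w^{i∞} g(ζ)ζʲ dζ` (`j ≤ 2`, via the tree's `powPrimitive`), centered moments
  `A₁, A₂` and their derivatives;
* §2 the lens `{Im w > a, a|w|² < Im w}` (convex, contains `i`) and the **`S`-identities**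
  `M₀(−1/w) = M₂ w − c₂`, `A₁(−1/w) = …`, `A₂(−1/w) = …` (zero derivative on a convex set);
* §3 `per`-periodicity of `A₁, A₂`; `c₁ = 2M₁(i)`, `c₀ = −c₂`; the candidate
  `Fbase(w) = Im A₂/Im w + 2Re A₁ + λ/Im w`, `per`-periodic and **`S`-invariant on the lens**
  (`Fbase_Sc`, granted `Im M₁(i) = 0`);
* §4 `Fbase` is `C²` with `(Im w)²Δ Fbase = 2 Fbase` (`laplacian_Fbase`, from the calculus lemmas
  of `GreenRhoEichlerIntegral`), and the **chart-transfer lemma** `laplacian_of_chart`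
  (`F ∘ ofComplex = Fbase ∘ μ` near `z` with `μ` holomorphic and `(Im z)|μ'(z)| = Im μ(z)` gives
  `C²` and `(Im z)²ΔF = 2F` at `z`);
* §5 the cusp bound `|Fbase w|·Im w ≤ C` on `|Re w| ≤ 1`, `Im w ≥ 2`;
* §6 the logarithmic singularity: from a local expansion `g = α(ζ−p)⁻² + b(ζ−p)⁻¹ + h` at a
  point `p` of height `a`, `Fbase(u) = −2α log‖u − p‖ + O(1)` (`Fbase_log_bound`);
* §7 the matching principle `higherGreen_eq_neg_card_div_mul` (any `IsResolventGreenLike N 2 z' F`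
  with `F = −2α log‖z − z'‖ + O(1)` equals `−(α/#Stab)⁻¹…`: precisely
  `higherGreen N 2 1 z z' = (−#Stab_{Γ₀(N)}(z')/α)·F z` off the orbit), by
  `resolventGreen_unique_holds` + `higherGreen_isResolventGreenLike_holds`;
* §8 the value at `i`: `Fbase(i) = 2 Im M₀(i)`, `M₀(i) = i∫_{t>1} g(it) dt`, and `Im M₁(i) = 0` when
  `g` is real on the imaginary axis.

## References

* Y. Zhou, *Kontsevich–Zagier integrals for automorphic Green's functions. I*, Ramanujan J. 38
  (2015), §2.2 and Remark 9. [cite: Zhou2015, Remark 9]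
* B. Gross, D. Zagier, *Heegner points and derivatives of L-series*, Invent. Math. 84 (1986),
  §II.2. [cite: GrossZagier1986, §II.2]
* E. Hecke, *Über die Bestimmung Dirichletscher Reihen durch ihre Funktionalgleichung*,
  Math. Ann. 112 (1936) (the groups `⟨S, T^λ⟩`, `λ = 2cos(π/m)`). [folklore]
-/

noncomputable section

open UpperHalfPlane hiding I
open Complex Filter Topology ModularForm Real Set MeasureTheory Laplacian
open scoped MatrixGroups Manifold Topology

namespace Literature.NumberTheory.Automorphic

open Literature.NumberTheory.EllipticCurves.ModularForms

/-- **A Hecke-type weight-4 datum**: `g : ℍ → ℂ` holomorphic on `Im > a` (`0 < a < 1`),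
`per`-periodic (`0 < per ≤ 2`), `g(−1/τ) = τ⁴ g(τ)`, and `g → 0` at `i∞`. [folklore] -/
structure HeckeFormData where
  /-- the weight-4 function -/
  g : ℍ → ℂ
  /-- the pole height -/
  a : ℝ
  /-- the period (cusp width) -/
  per : ℝ
  a_pos : 0 < a
  a_lt_one : a < 1
  per_pos : 0 < per
  per_le_two : per ≤ 2
  differentiableAt_g : ∀ w : ℂ, a < w.im → DifferentiableAt ℂ (g ∘ ofComplex) w
  S_law : ∀ τ : ℍ, g (ModularGroup.S • τ) = (τ : ℂ) ^ 4 * g τ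
  T_law : ∀ τ : ℍ, g (per +ᵥ τ) = g τ
  tendsto_g : Tendsto g atImInfty (𝓝 0)

namespace HeckeFormData

variable (D : HeckeFormData)

/-! ## 1. The shifted cusp function and the moments -/

/-- The shift `τ ↦ τ + i a`. [folklore] -/
def shiftUp (τ : ℍ) : ℍ := ⟨(τ : ℂ) + (D.a : ℂ) * Complex.I, by
  simp only [Complex.add_im, UpperHalfPlane.coe_im, Complex.mul_im, Complex.ofReal_re,
    Complex.I_im, mul_one, Complex.ofReal_im, Complex.I_re, mul_zero, add_zero]
  exact add_pos τ.im_pos D.a_pos⟩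

/-- Coercion of `shiftUp`. [folklore] -/
@[simp] theorem coe_shiftUp (τ : ℍ) : ((D.shiftUp τ : ℍ) : ℂ) = (τ : ℂ) + (D.a : ℂ) * Complex.I := rfl

/-- Height of `shiftUp`. [folklore] -/
theorem shiftUp_im (τ : ℍ) : (D.shiftUp τ).im = τ.im + D.a := by
  rw [← UpperHalfPlane.coe_im, coe_shiftUp]; simp

/-- `shiftUp` through `ofComplex`. [folklore] -/
theorem shiftUp_ofComplex {w : ℂ} (hw : 0 < w.im) :
    D.shiftUp (ofComplex w) = ofComplex (w + (D.a : ℂ) * Complex.I) := by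
  apply UpperHalfPlane.ext
  rw [coe_shiftUp, ofComplex_apply_of_im_pos hw,
    ofComplex_apply_of_im_pos (by simp; linarith [D.a_pos])]

/-- `φ := g ∘ shiftUp`. [folklore] -/
def φ (τ : ℍ) : ℂ := D.g (D.shiftUp τ)

/-- `φ` through `ofComplex`. [folklore] -/
theorem φ_ofComplex {w : ℂ} (hw : 0 < w.im) :
    D.φ (ofComplex w) = (D.g ∘ ofComplex) (w + (D.a : ℂ) * Complex.I) := by
  rw [φ, shiftUp_ofComplex D hw, Function.comp_apply]

/-- `shiftUp → i∞`. [folklore] -/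
theorem tendsto_shiftUp_atImInfty : Tendsto D.shiftUp atImInfty atImInfty := by
  rw [atImInfty, tendsto_comap_iff]
  have : (UpperHalfPlane.im ∘ D.shiftUp) = fun τ => τ.im + D.a := funext fun τ => D.shiftUp_im τ
  rw [this]
  exact tendsto_atTop_add_const_right _ D.a tendsto_comap

/-- Translation by `per` through `ofComplex`. [folklore] -/
theorem ofComplex_add_per {w : ℂ} (hw : 0 < w.im) :
    ofComplex (w + D.per) = ((D.per : ℝ) +ᵥ ofComplex w : ℍ) := by
  have hw' : 0 < (w + D.per).im := by simpa using hw
  apply UpperHalfPlane.ext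
  rw [ofComplex_apply_of_im_pos hw', UpperHalfPlane.coe_vadd, ofComplex_apply_of_im_pos hw]
  push_cast; ring

/-- **`φ` is a cusp function** (`per`-periodic, holomorphic on `ℍ`, `→ 0` at `i∞`). [folklore] -/
theorem isCuspFunction_φ : IsCuspFunction D.per D.φ where
  pos := D.per_pos
  periodic := by
    intro w
    simp only [Function.comp_apply]
    by_cases hw : 0 < w.im
    · have hw1 : 0 < (w + D.per).im := by simpa using hw
      rw [D.φ_ofComplex hw, D.φ_ofComplex hw1, Function.comp_apply, Function.comp_apply]
      have him : 0 < (w + (D.a : ℂ) * Complex.I).im := by simp; linarith [D.a_pos]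
      have e : w + D.per + (D.a : ℂ) * Complex.I = (w + (D.a : ℂ) * Complex.I) + D.per := by ring
      rw [e, D.ofComplex_add_per him, D.T_law]
    · push Not at hw
      have hw1 : (w + D.per).im ≤ 0 := by simpa using hw
      rw [φ, φ, ofComplex_apply_of_im_nonpos hw1, ofComplex_apply_of_im_nonpos hw]
  mdifferentiable := by
    rw [UpperHalfPlane.mdifferentiable_iff]
    intro w hw
    have hw' : 0 < w.im := hw
    have hd : DifferentiableAt ℂ (fun u : ℂ => (D.g ∘ ofComplex) (u + (D.a : ℂ) * Complex.I)) w := by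
      have h1 := D.differentiableAt_g (w + (D.a : ℂ) * Complex.I) (by simp; linarith)
      have h2 : DifferentiableAt ℂ (fun u : ℂ => u + (D.a : ℂ) * Complex.I) w :=
        differentiableAt_id.add_const _
      exact DifferentiableAt.comp (g := D.g ∘ ofComplex) w h1 h2
    refine (hd.congr_of_eventuallyEq ?_).differentiableWithinAt
    filter_upwards [isOpen_upperHalfPlaneSet.mem_nhds hw'] with u hu
    exact D.φ_ofComplex hu
  isZeroAtImInfty := by
    rw [UpperHalfPlane.IsZeroAtImInfty, ZeroAtFilter]
    exact D.tendsto_g.comp D.tendsto_shiftUp_atImInfty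

/-- `P_k(τ) := powPrimitive k φ τ` through `ofComplex`. [folklore] -/
def Pk (k : ℕ) (τ : ℂ) : ℂ := powPrimitive k D.φ (ofComplex τ)

/-- Derivative of `P_k`. [folklore] -/
theorem hasDerivAt_Pk (k : ℕ) {τ : ℂ} (hτ : 0 < τ.im) :
    HasDerivAt (D.Pk k) (-(D.φ (ofComplex τ) * τ ^ k)) τ :=
  D.isCuspFunction_φ.hasDerivAt_powPrimitive k hτ

/-- `g(w)` through `ofComplex` equals `φ(w − i a)`. [folklore] -/
theorem φ_ofComplex_sub {w : ℂ} (hw : D.a < w.im) :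
    D.φ (ofComplex (w - (D.a : ℂ) * Complex.I)) = D.g (ofComplex w) := by
  have h : 0 < (w - (D.a : ℂ) * Complex.I).im := by simp; linarith
  rw [D.φ_ofComplex h, Function.comp_apply, sub_add_cancel]

/-- `M₀(w) = ∫_w^{i∞} g`. [folklore] -/
def M₀ (w : ℂ) : ℂ := D.Pk 0 (w - (D.a : ℂ) * Complex.I)
/-- `M₁(w) = ∫_w^{i∞} g(ζ) ζ dζ`. [folklore] -/
def M₁ (w : ℂ) : ℂ := D.Pk 1 (w - (D.a : ℂ) * Complex.I) + (D.a : ℂ) * Complex.I * D.Pk 0 (w - (D.a : ℂ) * Complex.I)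
/-- `M₂(w) = ∫_w^{i∞} g(ζ) ζ² dζ`. [folklore] -/
def M₂ (w : ℂ) : ℂ := D.Pk 2 (w - (D.a : ℂ) * Complex.I) +
  2 * ((D.a : ℂ) * Complex.I) * D.Pk 1 (w - (D.a : ℂ) * Complex.I) +
  ((D.a : ℂ) * Complex.I) ^ 2 * D.Pk 0 (w - (D.a : ℂ) * Complex.I)

/-- `gC w := g(ofComplex w)`. [folklore] -/
def gC (w : ℂ) : ℂ := D.g (ofComplex w)

/-- `M₀' = −g`. [folklore] -/
theorem hasDerivAt_M₀ {w : ℂ} (hw : D.a < w.im) : HasDerivAt D.M₀ (-(D.gC w)) w := by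
  have h : 0 < (w - (D.a : ℂ) * Complex.I).im := by simp; linarith
  have := (D.hasDerivAt_Pk 0 h).comp w ((hasDerivAt_id w).sub_const ((D.a : ℂ) * Complex.I))
  refine (this.congr_of_eventuallyEq (Eventually.of_forall fun u => rfl)).congr_deriv ?_
  rw [D.φ_ofComplex_sub hw, gC]; simp

/-- `M₁' = −g w`. [folklore] -/
theorem hasDerivAt_M₁ {w : ℂ} (hw : D.a < w.im) : HasDerivAt D.M₁ (-(D.gC w * w)) w := by
  have h : 0 < (w - (D.a : ℂ) * Complex.I).im := by simp; linarith
  have hs := (hasDerivAt_id w).sub_const ((D.a : ℂ) * Complex.I)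
  have h1 := (D.hasDerivAt_Pk 1 h).comp w hs
  have h0 := ((D.hasDerivAt_Pk 0 h).comp w hs).const_mul ((D.a : ℂ) * Complex.I)
  have := h1.add h0
  refine (this.congr_of_eventuallyEq (Eventually.of_forall fun u => rfl)).congr_deriv ?_
  rw [D.φ_ofComplex_sub hw, gC]; simp; ring

/-- `M₂' = −g w²`. [folklore] -/
theorem hasDerivAt_M₂ {w : ℂ} (hw : D.a < w.im) : HasDerivAt D.M₂ (-(D.gC w * w ^ 2)) w := by
  have h : 0 < (w - (D.a : ℂ) * Complex.I).im := by simp; linarith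
  have hs := (hasDerivAt_id w).sub_const ((D.a : ℂ) * Complex.I)
  have h2 := (D.hasDerivAt_Pk 2 h).comp w hs
  have h1 := ((D.hasDerivAt_Pk 1 h).comp w hs).const_mul (2 * ((D.a : ℂ) * Complex.I))
  have h0 := ((D.hasDerivAt_Pk 0 h).comp w hs).const_mul (((D.a : ℂ) * Complex.I) ^ 2)
  have := (h2.add h1).add h0
  refine (this.congr_of_eventuallyEq (Eventually.of_forall fun u => rfl)).congr_deriv ?_
  rw [D.φ_ofComplex_sub hw, gC]; simp; ring

/-- Centered moment `A₁(w) = ∫_w^{i∞} g(ζ)(ζ − w) dζ`. [folklore] -/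
def A₁ (w : ℂ) : ℂ := D.M₁ w - w * D.M₀ w
/-- `A₂(w) = ∫_w^{i∞} g(ζ)(ζ − w)² dζ`. [folklore] -/
def A₂ (w : ℂ) : ℂ := D.M₂ w - 2 * w * D.M₁ w + w ^ 2 * D.M₀ w

/-- `A₁' = −M₀`. [folklore] -/
theorem hasDerivAt_A₁ {w : ℂ} (hw : D.a < w.im) : HasDerivAt D.A₁ (-(D.M₀ w)) w := by
  have := (D.hasDerivAt_M₁ hw).sub ((hasDerivAt_id w).mul (D.hasDerivAt_M₀ hw))
  refine (this.congr_of_eventuallyEq (Eventually.of_forall fun u => rfl)).congr_deriv ?_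
  simp; ring

/-- `A₂' = −2A₁`. [folklore] -/
theorem hasDerivAt_A₂ {w : ℂ} (hw : D.a < w.im) : HasDerivAt D.A₂ (-(2 * D.A₁ w)) w := by
  have h1 := ((hasDerivAt_id w).const_mul 2).mul (D.hasDerivAt_M₁ hw)
  have h0 := ((hasDerivAt_id w).pow 2).mul (D.hasDerivAt_M₀ hw)
  have := ((D.hasDerivAt_M₂ hw).sub h1).add h0
  refine (this.congr_of_eventuallyEq (Eventually.of_forall fun u => rfl)).congr_deriv ?_
  simp [A₁]; ring

/-! ## 2. The lens and the `S`-identities -/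

/-- The lens `{Im w > a, Im(−1/w) > a}`. [folklore] -/
def lens : Set ℂ := {w : ℂ | D.a < w.im ∧ D.a * Complex.normSq w < w.im}

/-- Membership in the lens. [folklore] -/
theorem mem_lens_iff {w : ℂ} : w ∈ D.lens ↔ D.a < w.im ∧ D.a < (-w⁻¹).im := by
  rw [lens, Set.mem_setOf_eq, GreenRho.im_neg_inv]
  constructor
  · rintro ⟨h1, h2⟩
    have hn : 0 < Complex.normSq w := Complex.normSq_pos.mpr (by
      rintro rfl; simp at h1; linarith [D.a_pos])
    exact ⟨h1, by rwa [lt_div_iff₀ hn]⟩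
  · rintro ⟨h1, h2⟩
    have hn : 0 < Complex.normSq w := Complex.normSq_pos.mpr (by
      rintro rfl; simp at h1; linarith [D.a_pos])
    exact ⟨h1, by rwa [lt_div_iff₀ hn] at h2⟩

/-- The lens is open. [folklore] -/
theorem isOpen_lens : IsOpen D.lens := by
  have h1 : IsOpen {w : ℂ | D.a < w.im} := isOpen_lt continuous_const Complex.continuous_im
  have h2 : IsOpen {w : ℂ | D.a * Complex.normSq w < w.im} :=
    isOpen_lt (continuous_const.mul Complex.continuous_normSq) Complex.continuous_im
  exact h1.inter h2

/-- **The lens is convex.** [folklore] -/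
theorem convex_lens : Convex ℝ D.lens := by
  rw [convex_iff_forall_pos]
  intro w₁ hw₁ w₂ hw₂ s t hs ht hst
  obtain ⟨h1a, h1b⟩ := hw₁
  obtain ⟨h2a, h2b⟩ := hw₂
  have ht' : t = 1 - s := by linarith
  subst ht'
  refine ⟨?_, ?_⟩
  · simp only [Complex.add_im, Complex.real_smul, Complex.mul_im, Complex.ofReal_re,
      Complex.ofReal_im, zero_mul, add_zero]
    nlinarith
  · have hid := GreenRho.normSq_convex_combo w₁ w₂ s
    have hnn : 0 ≤ s * (1 - s) * Complex.normSq (w₁ - w₂) :=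
      mul_nonneg (mul_nonneg hs.le ht.le) (Complex.normSq_nonneg _)
    simp only [Complex.add_im, Complex.real_smul, Complex.mul_im, Complex.ofReal_re,
      Complex.ofReal_im, zero_mul, add_zero]
    calc D.a * Complex.normSq ((s : ℂ) * w₁ + ((1 - s : ℝ) : ℂ) * w₂)
        ≤ D.a * (s * Complex.normSq w₁ + (1 - s) * Complex.normSq w₂) := by
          apply mul_le_mul_of_nonneg_left _ D.a_pos.le; linarith
      _ = s * (D.a * Complex.normSq w₁) + (1 - s) * (D.a * Complex.normSq w₂) := by ring
      _ < s * w₁.im + (1 - s) * w₂.im := by nlinarith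

/-- `i` lies in the lens (`a < 1`). [folklore] -/
theorem I_mem_lens : Complex.I ∈ D.lens := by
  refine ⟨by simpa using D.a_lt_one, ?_⟩
  simp [Complex.normSq_I]; exact D.a_lt_one

/-- Points of the lens are nonzero. [folklore] -/
theorem lens_ne_zero {w : ℂ} (hw : w ∈ D.lens) : w ≠ 0 := by
  rintro rfl; have := hw.1; simp at this; linarith [D.a_pos]

/-- Points of the lens lie in the upper half-plane. [folklore] -/
theorem lens_im_pos {w : ℂ} (hw : w ∈ D.lens) : 0 < w.im := D.a_pos.trans hw.1

/-- `Im(−1/w) > a` on the lens. [folklore] -/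
theorem Sc_im {w : ℂ} (hw : w ∈ D.lens) : D.a < (GreenRho.Sc w).im := (D.mem_lens_iff.mp hw).2

/-- **`g(−1/w) = w⁴ g(w)`** through `ofComplex`. [folklore] -/
theorem gC_Sc {w : ℂ} (hw : 0 < w.im) : D.gC (GreenRho.Sc w) = w ^ 4 * D.gC w := by
  rw [gC, gC, GreenRho.ofComplex_Sc hw, D.S_law, ofComplex_apply_of_im_pos hw]

/-- (I₀) has zero derivative on the lens. [folklore] -/
theorem hasDerivAt_I₀ {w : ℂ} (hw : w ∈ D.lens) :
    HasDerivAt (fun w => D.M₀ (GreenRho.Sc w) - D.M₂ w) 0 w := by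
  have hw0 := D.lens_ne_zero hw
  have h1 := (D.hasDerivAt_M₀ (D.Sc_im hw)).comp w (GreenRho.hasDerivAt_Sc hw0)
  have h2 := D.hasDerivAt_M₂ hw.1
  have := h1.sub h2
  refine (this.congr_of_eventuallyEq (Eventually.of_forall fun u => rfl)).congr_deriv ?_
  rw [D.gC_Sc (D.lens_im_pos hw)]
  field_simp
  ring

/-- The constant `c₂ := M₂(i) − M₀(i)`. [folklore] -/
def c₂ : ℂ := D.M₂ Complex.I - D.M₀ Complex.I

/-- **(I₀) on the lens**: `M₀(−1/w) = M₂(w) − c₂`. [folklore] -/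
theorem M₀_Sc {w : ℂ} (hw : w ∈ D.lens) : D.M₀ (GreenRho.Sc w) = D.M₂ w - D.c₂ := by
  have h := IsOpen.is_const_of_deriv_eq_zero (f := fun w => D.M₀ (GreenRho.Sc w) - D.M₂ w) D.isOpen_lens
    D.convex_lens.isPreconnected
    (fun u hu => (D.hasDerivAt_I₀ hu).differentiableAt.differentiableWithinAt)
    (fun u hu => (D.hasDerivAt_I₀ hu).deriv) hw D.I_mem_lens
  simp only [GreenRho.Sc_I] at h
  rw [c₂]; linear_combination h

/-- The constant `c₁` fixed by (I₁) at `w = i`. [folklore] -/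
def c₁ : ℂ := D.A₁ Complex.I - (D.M₂ Complex.I - D.c₂) / Complex.I + D.M₁ Complex.I

/-- (I₁) has zero derivative on the lens. [folklore] -/
theorem hasDerivAt_I₁ {w : ℂ} (hw : w ∈ D.lens) :
    HasDerivAt (fun w => D.A₁ (GreenRho.Sc w) - (D.M₂ w - D.c₂) / w + (D.M₁ w - D.c₁)) 0 w := by
  have hw0 := D.lens_ne_zero hw
  have h1 := (D.hasDerivAt_A₁ (D.Sc_im hw)).comp w (GreenRho.hasDerivAt_Sc hw0)
  have h2 := ((D.hasDerivAt_M₂ hw.1).sub_const D.c₂).div (hasDerivAt_id w) hw0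
  have h3 := (D.hasDerivAt_M₁ hw.1).sub_const D.c₁
  have := (h1.sub h2).add h3
  refine (this.congr_of_eventuallyEq (Eventually.of_forall fun u => rfl)).congr_deriv ?_
  simp only [id]
  rw [D.M₀_Sc hw]
  field_simp
  ring

/-- **(I₁) on the lens**: `A₁(−1/w) = ((M₂ w − c₂) − w (M₁ w − c₁))/w`. [folklore] -/
theorem A₁_Sc {w : ℂ} (hw : w ∈ D.lens) :
    D.A₁ (GreenRho.Sc w) = ((D.M₂ w - D.c₂) - w * (D.M₁ w - D.c₁)) / w := by
  have h := IsOpen.is_const_of_deriv_eq_zero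
    (f := fun w => D.A₁ (GreenRho.Sc w) - (D.M₂ w - D.c₂) / w + (D.M₁ w - D.c₁)) D.isOpen_lens
    D.convex_lens.isPreconnected
    (fun u hu => (D.hasDerivAt_I₁ hu).differentiableAt.differentiableWithinAt)
    (fun u hu => (D.hasDerivAt_I₁ hu).deriv) hw D.I_mem_lens
  simp only [GreenRho.Sc_I] at h
  have h0 : D.A₁ Complex.I - (D.M₂ Complex.I - D.c₂) / Complex.I + (D.M₁ Complex.I - D.c₁) = 0 := by
    rw [c₁]; ring
  rw [h0] at h
  have hw0 := D.lens_ne_zero hw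
  have e : ((D.M₂ w - D.c₂) - w * (D.M₁ w - D.c₁)) / w = (D.M₂ w - D.c₂) / w - (D.M₁ w - D.c₁) := by
    field_simp
  rw [e]
  linear_combination h

/-- The constant `c₀` fixed by (I₂) at `w = i`. [folklore] -/
def c₀ : ℂ := -D.A₂ Complex.I - (D.M₂ Complex.I - D.c₂) + 2 * Complex.I * (D.M₁ Complex.I - D.c₁) + D.M₀ Complex.I

/-- (I₂) has zero derivative on the lens. [folklore] -/
theorem hasDerivAt_I₂ {w : ℂ} (hw : w ∈ D.lens) :
    HasDerivAt (fun w => D.A₂ (GreenRho.Sc w) -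
      ((D.M₂ w - D.c₂) - 2 * w * (D.M₁ w - D.c₁) + w ^ 2 * (D.M₀ w - D.c₀)) / w ^ 2) 0 w := by
  have hw0 := D.lens_ne_zero hw
  have h1 := (D.hasDerivAt_A₂ (D.Sc_im hw)).comp w (GreenRho.hasDerivAt_Sc hw0)
  have hB := (((D.hasDerivAt_M₂ hw.1).sub_const D.c₂).fun_sub
    (((hasDerivAt_id' w).const_mul 2).fun_mul ((D.hasDerivAt_M₁ hw.1).sub_const D.c₁))).fun_add
    ((hasDerivAt_pow 2 w).fun_mul ((D.hasDerivAt_M₀ hw.1).sub_const D.c₀))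
  have h2 := hB.fun_div (hasDerivAt_pow 2 w) (pow_ne_zero 2 hw0)
  have := h1.fun_sub h2
  refine (this.congr_of_eventuallyEq (Eventually.of_forall fun u => rfl)).congr_deriv ?_
  rw [D.A₁_Sc hw]
  field_simp
  ring

/-- **(I₂) on the lens**: `A₂(−1/w) = ((M₂ w − c₂) − 2w(M₁ w − c₁) + w²(M₀ w − c₀))/w²`. [folklore] -/
theorem A₂_Sc {w : ℂ} (hw : w ∈ D.lens) :
    D.A₂ (GreenRho.Sc w) = ((D.M₂ w - D.c₂) - 2 * w * (D.M₁ w - D.c₁) + w ^ 2 * (D.M₀ w - D.c₀)) / w ^ 2 := by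
  have h := IsOpen.is_const_of_deriv_eq_zero
    (f := fun w => D.A₂ (GreenRho.Sc w) -
      ((D.M₂ w - D.c₂) - 2 * w * (D.M₁ w - D.c₁) + w ^ 2 * (D.M₀ w - D.c₀)) / w ^ 2)
    D.isOpen_lens D.convex_lens.isPreconnected
    (fun u hu => (D.hasDerivAt_I₂ hu).differentiableAt.differentiableWithinAt)
    (fun u hu => (D.hasDerivAt_I₂ hu).deriv) hw D.I_mem_lens
  simp only [GreenRho.Sc_I] at h
  have h0 : D.A₂ Complex.I - ((D.M₂ Complex.I - D.c₂) - 2 * Complex.I * (D.M₁ Complex.I - D.c₁) +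
      Complex.I ^ 2 * (D.M₀ Complex.I - D.c₀)) / Complex.I ^ 2 = 0 := by
    rw [c₀, Complex.I_sq]; ring
  rw [h0] at h
  linear_combination h

/-! ## 3. Periodicity and the function `Fbase` -/

/-- `P₀` is `per`-periodic. [folklore] -/
theorem Pk0_add_per (τ : ℂ) : D.Pk 0 (τ + D.per) = D.Pk 0 τ := by
  have := D.isCuspFunction_φ.periodic_eichlerPrimitive τ
  simpa [Pk] using this

/-- `P₁(τ + per) = P₁ τ + per·P₀ τ`. [folklore] -/
theorem Pk1_add_per {τ : ℂ} (hτ : 0 < τ.im) : D.Pk 1 (τ + D.per) = D.Pk 1 τ + D.per * D.Pk 0 τ := by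
  have hτ' : 0 < (τ + D.per).im := by simpa using hτ
  have hE := D.isCuspFunction_φ.primitive.periodic_eichlerPrimitive τ
  have hP := D.isCuspFunction_φ.periodic_eichlerPrimitive τ
  simp only [Function.comp_apply] at hE hP
  simp only [Pk, powPrimitive_succ, powPrimitive_zero, ofComplex_apply_of_im_pos hτ,
    ofComplex_apply_of_im_pos hτ']
  rw [← ofComplex_apply_of_im_pos hτ, ← ofComplex_apply_of_im_pos hτ', hE, hP]
  push_cast; ring

/-- `P₂(τ + per) = P₂ τ + 2per·P₁ τ + per²·P₀ τ`. [folklore] -/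
theorem Pk2_add_per {τ : ℂ} (hτ : 0 < τ.im) :
    D.Pk 2 (τ + D.per) = D.Pk 2 τ + 2 * D.per * D.Pk 1 τ + D.per ^ 2 * D.Pk 0 τ := by
  have hτ' : 0 < (τ + D.per).im := by simpa using hτ
  have hP := D.isCuspFunction_φ.periodic_eichlerPrimitive τ
  have hE := D.isCuspFunction_φ.primitive.periodic_eichlerPrimitive τ
  have hE3 := D.isCuspFunction_φ.primitive.primitive.periodic_eichlerPrimitive τ
  simp only [Function.comp_apply] at hE hP hE3
  simp only [Pk, powPrimitive_succ, powPrimitive_zero, ofComplex_apply_of_im_pos hτ,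
    ofComplex_apply_of_im_pos hτ']
  rw [← ofComplex_apply_of_im_pos hτ, ← ofComplex_apply_of_im_pos hτ', hE, hP, hE3]
  push_cast; ring

/-- `M₀` is `per`-periodic. [folklore] -/
theorem M₀_add_per (w : ℂ) : D.M₀ (w + D.per) = D.M₀ w := by
  rw [M₀, M₀, show w + D.per - (D.a : ℂ) * Complex.I = (w - (D.a : ℂ) * Complex.I) + D.per by ring,
    Pk0_add_per]

/-- `M₁(w + per) = M₁ w + per·M₀ w`. [folklore] -/
theorem M₁_add_per {w : ℂ} (hw : D.a < w.im) : D.M₁ (w + D.per) = D.M₁ w + D.per * D.M₀ w := by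
  have h : 0 < (w - (D.a : ℂ) * Complex.I).im := by simp; linarith
  rw [M₁, M₁, M₀, show w + D.per - (D.a : ℂ) * Complex.I = (w - (D.a : ℂ) * Complex.I) + D.per by ring,
    D.Pk1_add_per h, Pk0_add_per]
  ring

/-- `M₂(w + per) = M₂ w + 2per·M₁ w + per²·M₀ w`. [folklore] -/
theorem M₂_add_per {w : ℂ} (hw : D.a < w.im) :
    D.M₂ (w + D.per) = D.M₂ w + 2 * D.per * D.M₁ w + D.per ^ 2 * D.M₀ w := by
  have h : 0 < (w - (D.a : ℂ) * Complex.I).im := by simp; linarith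
  rw [M₂, M₂, M₁, M₀, show w + D.per - (D.a : ℂ) * Complex.I = (w - (D.a : ℂ) * Complex.I) + D.per by ring,
    D.Pk2_add_per h, D.Pk1_add_per h, Pk0_add_per]
  ring

/-- **`A₁` is `per`-periodic.** [folklore] -/
theorem A₁_add_per {w : ℂ} (hw : D.a < w.im) : D.A₁ (w + D.per) = D.A₁ w := by
  rw [A₁, A₁, D.M₁_add_per hw, D.M₀_add_per w]; ring

/-- **`A₂` is `per`-periodic.** [folklore] -/
theorem A₂_add_per {w : ℂ} (hw : D.a < w.im) : D.A₂ (w + D.per) = D.A₂ w := by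
  rw [A₂, A₂, D.M₂_add_per hw, D.M₁_add_per hw, D.M₀_add_per w]; ring

/-- `c₁ = 2M₁(i)`. [folklore] -/
theorem c₁_eq : D.c₁ = 2 * D.M₁ Complex.I := by
  rw [c₁, c₂, A₁]
  have hI : Complex.I ≠ 0 := Complex.I_ne_zero
  field_simp
  ring_nf
  rw [Complex.I_sq]; ring

/-- `c₀ = −c₂`. [folklore] -/
theorem c₀_eq : D.c₀ = -D.c₂ := by
  rw [c₀, c₁_eq, c₂, A₂]
  ring_nf
  rw [Complex.I_sq]; ring

/-- `λ := Im c₀`. [folklore] -/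
def lam : ℝ := D.c₀.im

/-- `u(w) := A₂(w) + 2i·Im(w)·A₁(w)`. [folklore] -/
def uC (w : ℂ) : ℂ := D.A₂ w + 2 * Complex.I * (w.im : ℂ) * D.A₁ w

/-- **The candidate Green function on `Im w > a`**: `Fbase(w) = Im A₂/y + 2 Re A₁ + λ/y`. [folklore] -/
def Fbase (w : ℂ) : ℝ := (D.A₂ w).im / w.im + 2 * (D.A₁ w).re + D.lam / w.im

/-- Imaginary part of `u`. [folklore] -/
theorem uC_im (w : ℂ) : (D.uC w).im = (D.A₂ w).im + 2 * w.im * (D.A₁ w).re := by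
  rw [uC]
  simp only [Complex.add_im, Complex.mul_im, Complex.mul_re, Complex.I_re, Complex.I_im,
    Complex.ofReal_re, Complex.ofReal_im, Complex.re_ofNat, Complex.im_ofNat]
  ring

/-- `Fbase = (Im u + λ)/y`. [folklore] -/
theorem Fbase_eq (w : ℂ) (hw : 0 < w.im) : D.Fbase w = ((D.uC w).im + D.lam) / w.im := by
  rw [Fbase, uC_im]
  field_simp

/-- `Fbase` is `per`-periodic. [folklore] -/
theorem Fbase_add_per {w : ℂ} (hw : D.a < w.im) : D.Fbase (w + D.per) = D.Fbase w := by
  rw [Fbase, Fbase, D.A₂_add_per hw, D.A₁_add_per hw]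
  simp

/-- `Fbase` is invariant under integer multiples of the period. [folklore] -/
theorem Fbase_add_int_mul_per {w : ℂ} (hw : D.a < w.im) (n : ℤ) :
    D.Fbase (w + n * D.per) = D.Fbase w := by
  induction n using Int.induction_on with
  | zero => simp
  | succ n ih =>
      have h : D.a < (w + (n : ℂ) * D.per).im := by simpa using hw
      have := D.Fbase_add_per h
      push_cast at this ih ⊢
      rw [show w + ((n : ℂ) + 1) * D.per = w + (n : ℂ) * D.per + D.per by ring, this, ih]
  | pred n ih =>
      have h : D.a < (w + ((-(n : ℤ) - 1 : ℤ) : ℂ) * D.per).im := by simpa using hw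
      have := D.Fbase_add_per h
      rw [← this]
      push_cast at ih ⊢
      rw [show w + (-(n : ℂ) - 1) * D.per + D.per = w + -(n : ℂ) * D.per by ring, ih]

/-- `|w|²·u(−1/w) = u(w) − c₂ + 2c₁·Re w − c₀|w|²` on the lens. [folklore] -/
theorem normSq_mul_uC_Sc {w : ℂ} (hw : w ∈ D.lens) :
    (Complex.normSq w : ℂ) * D.uC (GreenRho.Sc w) =
      D.uC w - D.c₂ + 2 * D.c₁ * (w.re : ℂ) - D.c₀ * Complex.normSq w := by
  have hw0 := D.lens_ne_zero hw
  have hA2 := D.A₂_Sc hw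
  have hA1 := D.A₁_Sc hw
  have hSim : ((GreenRho.Sc w).im : ℂ) = (w.im : ℂ) / Complex.normSq w := by
    rw [GreenRho.Sc, GreenRho.im_neg_inv]; push_cast; rfl
  rw [uC, uC, hA2, hA1, hSim]
  have hn : (Complex.normSq w : ℂ) = w * (starRingEnd ℂ) w := (Complex.mul_conj w).symm
  have hn0 : (Complex.normSq w : ℂ) ≠ 0 := by exact_mod_cast (Complex.normSq_pos.mpr hw0).ne'
  have hc0 : (starRingEnd ℂ) w ≠ 0 := (map_ne_zero (starRingEnd ℂ)).mpr hw0
  have hre : ((w.re : ℂ)) = (w + (starRingEnd ℂ) w) / 2 := by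
    rw [Complex.add_conj]; push_cast; ring
  have him : ((w.im : ℂ)) = (w - (starRingEnd ℂ) w) / (2 * Complex.I) := by
    rw [Complex.sub_conj]; push_cast; field_simp
  rw [A₂, A₁] at *
  rw [hre, him, hn]
  field_simp
  ring

/-- **`S`-invariance of `Fbase` on the lens**, granted `Im M₁(i) = 0`. [folklore] -/
theorem Fbase_Sc {w : ℂ} (hw : w ∈ D.lens) (hreal : (D.M₁ Complex.I).im = 0) :
    D.Fbase (GreenRho.Sc w) = D.Fbase w := by
  have hw0 := D.lens_ne_zero hw
  have hy := D.lens_im_pos hw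
  have hn := Complex.normSq_pos.mpr hw0
  have hSy : (GreenRho.Sc w).im = w.im / Complex.normSq w := by rw [GreenRho.Sc, GreenRho.im_neg_inv]
  have hSy0 : 0 < (GreenRho.Sc w).im := by rw [hSy]; exact div_pos hy hn
  rw [D.Fbase_eq _ hSy0, D.Fbase_eq _ hy, hSy]
  have key := D.normSq_mul_uC_Sc hw
  have hc1 : D.c₁.im = 0 := by rw [c₁_eq]; simp [hreal]
  have hlam : D.lam = -D.c₂.im := by rw [lam, c₀_eq]; simp
  have him := congrArg Complex.im key
  have e1 : ((Complex.normSq w : ℂ) * D.uC (GreenRho.Sc w)).im = Complex.normSq w * (D.uC (GreenRho.Sc w)).im := by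
    simp [Complex.mul_im]
  have e2 : (D.uC w - D.c₂ + 2 * D.c₁ * (w.re : ℂ) - D.c₀ * (Complex.normSq w : ℂ)).im =
      (D.uC w).im - D.c₂.im + 2 * w.re * D.c₁.im - Complex.normSq w * D.c₀.im := by
    simp only [Complex.sub_im, Complex.add_im, Complex.mul_im, Complex.ofReal_re, Complex.ofReal_im,
      Complex.re_ofNat, Complex.im_ofNat, mul_zero, zero_mul, add_zero, zero_add]
    ring
  rw [e1, e2, hc1, c₀_eq, Complex.neg_im] at him
  rw [hlam, div_div_eq_mul_div, eq_div_iff hy.ne', div_mul_cancel₀ _ hy.ne']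
  nlinarith [him]

/-! ## 4. `Fbase` is `C²` with `y²ΔFbase = 2Fbase`; transfer through holomorphic charts -/

/-- **`Fbase` is `C²` and `(Im w)² Δ Fbase = 2·Fbase` on `Im w > a`.** [folklore] -/
theorem laplacian_Fbase {w : ℂ} (hw : D.a < w.im) :
    ContDiffAt ℝ 2 D.Fbase w ∧ w.im ^ 2 * Δ D.Fbase w = 2 * D.Fbase w := by
  have hy : 0 < w.im := D.a_pos.trans hw
  have hA2 : ∀ z : ℂ, D.a < z.im → HasDerivAt D.A₂ (-(2 * D.A₁ z)) z := fun z hz => D.hasDerivAt_A₂ hz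
  have hA1' : ∀ z : ℂ, D.a < z.im → HasDerivAt (fun z => -(2 * D.A₁ z)) (2 * D.M₀ z) z := fun z hz =>
    (((D.hasDerivAt_A₁ hz).const_mul 2).fun_neg).congr_deriv (by ring)
  have hA1 : ∀ z : ℂ, D.a < z.im → HasDerivAt (fun z => 2 * D.A₁ z) (-(2 * D.M₀ z)) z := fun z hz =>
    ((D.hasDerivAt_A₁ hz).const_mul 2).congr_deriv (by ring)
  have hM0 : ∀ z : ℂ, D.a < z.im → HasDerivAt (fun z => -(2 * D.M₀ z)) (2 * D.gC z) z := fun z hz =>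
    (((D.hasDerivAt_M₀ hz).const_mul 2).fun_neg).congr_deriv (by ring)
  obtain ⟨hc1, hl1⟩ := GreenRho.laplacian_im_div_im D.a_pos.le hA2 hA1' hw
  obtain ⟨hc2, hl2⟩ := GreenRho.laplacian_re_holo hA1 hM0 hw
  obtain ⟨hc3, hl3⟩ := GreenRho.laplacian_const_div_im D.lam hy
  have hF : D.Fbase = (fun z : ℂ => (D.A₂ z).im / z.im) + (fun z : ℂ => (2 * D.A₁ z).re) +
      fun z : ℂ => D.lam / z.im := by
    funext z; simp [Fbase, Complex.mul_re]
  have h12 : ContDiffAt ℝ 2 ((fun z : ℂ => (D.A₂ z).im / z.im) + fun z : ℂ => (2 * D.A₁ z).re) w :=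
    hc1.add hc2
  refine ⟨?_, ?_⟩
  · rw [hF]; exact h12.add hc3
  · rw [hF, h12.laplacian_add hc3, hc1.laplacian_add hc2]
    simp only [Pi.add_apply]
    have e2 : (2 * D.A₁ w).re = 2 * (D.A₁ w).re := by simp [Complex.mul_re]
    rw [mul_add, mul_add, hl1, hl3, hl2, mul_zero, add_zero, e2]
    simp only [Complex.neg_re, Complex.mul_re, Complex.re_ofNat, Complex.im_ofNat, zero_mul, sub_zero]
    field_simp
    ring

/-- **Chart transfer.** If near `z ∈ ℍ` the function `F ∘ ofComplex` agrees with `Fbase ∘ μ` for a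
map `μ` holomorphic near `z` with `Im μ(z) > a` and `(Im z)²‖μ'(z)‖² = (Im μ(z))²` (a hyperbolic
isometry into the half-plane `Im > a`), then `F` is `C²` at `z` with `(Im z)² ΔF(z) = 2F(z)`. [folklore] -/
theorem laplacian_of_chart {F : ℍ → ℝ} {z : ℍ} {μ : ℂ → ℂ}
    (hloc : (fun w : ℂ => F (ofComplex w)) =ᶠ[𝓝 (z : ℂ)] D.Fbase ∘ μ)
    (hμ : ∀ᶠ w in 𝓝 (z : ℂ), DifferentiableAt ℂ μ w) (him : D.a < (μ z).im)
    (hiso : z.im ^ 2 * ‖deriv μ z‖ ^ 2 = (μ z).im ^ 2) :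
    ContDiffAt ℝ 2 (fun w : ℂ => F (ofComplex w)) (z : ℂ) ∧
      realHypLaplacian F z = (2 : ℝ) * ((2 : ℝ) - 1) * F z := by
  obtain ⟨hcd, hlap⟩ := D.laplacian_Fbase him
  have hμan : AnalyticAt ℂ μ z := by
    obtain ⟨s, hs, hso, hzs⟩ := eventually_nhds_iff.mp hμ
    exact (DifferentiableOn.analyticOnNhd (fun w hw => (hs w hw).differentiableWithinAt) hso) z hzs
  have hμsmooth : ContDiffAt ℝ 2 μ (z : ℂ) := (hμan.contDiffAt).restrict_scalars ℝ
  have hval : F z = D.Fbase (μ z) := by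
    have := hloc.self_of_nhds
    simpa [ofComplex_apply] using this
  refine ⟨?_, ?_⟩
  · exact (hcd.comp (z : ℂ) hμsmooth).congr_of_eventuallyEq hloc
  · unfold realHypLaplacian
    rw [(InnerProductSpace.laplacian_congr_nhds hloc).eq_of_nhds,
      ConformalLaplacian.laplacian_comp_holomorphic hμ hcd, smul_eq_mul, hval]
    have hy : (μ z).im ≠ 0 := (D.a_pos.trans him).ne'
    calc z.im ^ 2 * (‖deriv μ z‖ ^ 2 * Δ D.Fbase (μ z))
        = (z.im ^ 2 * ‖deriv μ z‖ ^ 2) * Δ D.Fbase (μ z) := by ring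
      _ = (μ z).im ^ 2 * Δ D.Fbase (μ z) := by rw [hiso]
      _ = 2 * D.Fbase (μ z) := hlap
      _ = (2 : ℝ) * ((2 : ℝ) - 1) * D.Fbase (μ z) := by norm_num

/-! ## 5. The cusp bound -/

/-- Exponential decay of the moments on vertical strips: for `|Re w| ≤ 1`, `Im w ≥ 2`,
`‖P_k(w − ia)‖ ≤ C (2 + Im w)^k e^{−(2π/per)(Im w − a)}`. [folklore] -/
theorem exists_norm_Pk_le (k : ℕ) : ∃ C : ℝ, 0 ≤ C ∧ ∀ w : ℂ, |w.re| ≤ 1 → 2 ≤ w.im →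
    ‖D.Pk k (w - (D.a : ℂ) * Complex.I)‖ ≤
      C * (2 + w.im) ^ k * Real.exp (-(2 * π / D.per) * (w.im - D.a)) := by
  obtain ⟨C, hC0, hC⟩ := D.isCuspFunction_φ.exists_norm_powPrimitive_le k
  refine ⟨C, hC0, fun w hre hy => ?_⟩
  have him : (w - (D.a : ℂ) * Complex.I).im = w.im - D.a := by simp
  have hpos : 0 < (w - (D.a : ℂ) * Complex.I).im := by rw [him]; linarith [D.a_lt_one]
  set τ : ℍ := ⟨w - (D.a : ℂ) * Complex.I, hpos⟩ with hτ
  have hτim : τ.im = w.im - D.a := by rw [← UpperHalfPlane.coe_im]; exact him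
  have hτre : τ.re = w.re := by rw [← UpperHalfPlane.coe_re]; simp [hτ]
  have h1 : 1 ≤ τ.im := by rw [hτim]; linarith [D.a_lt_one]
  have h := hC τ h1
  rw [Pk, ofComplex_apply_of_im_pos hpos]
  refine h.trans ?_
  rw [hτim, hτre]
  have hb : (1 + |w.re| + (w.im - D.a)) ^ k ≤ (2 + w.im) ^ k := by
    apply pow_le_pow_left₀ (by linarith [abs_nonneg w.re, D.a_lt_one])
    linarith [D.a_pos]
  have he : 0 ≤ Real.exp (-(2 * π / D.per) * (w.im - D.a)) := (Real.exp_pos _).le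
  nlinarith [mul_le_mul_of_nonneg_right hb he, hC0, mul_nonneg hC0 he]

set_option maxHeartbeats 800000 in
/-- **Cusp bound**: `|Fbase w| · Im w ≤ C` for `|Re w| ≤ 1`, `Im w ≥ 2`. [folklore] -/
theorem exists_Fbase_cusp_bound :
    ∃ C : ℝ, ∀ w : ℂ, |w.re| ≤ 1 → 2 ≤ w.im → |D.Fbase w| * w.im ≤ C := by
  obtain ⟨C₀, hC₀, h0⟩ := D.exists_norm_Pk_le 0
  obtain ⟨C₁, hC₁, h1⟩ := D.exists_norm_Pk_le 1
  obtain ⟨C₂, hC₂, h2⟩ := D.exists_norm_Pk_le 2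
  set K : ℝ := C₀ + C₁ + C₂ with hK
  have hK0 : 0 ≤ K := by rw [hK]; positivity
  have hKC₀ : C₀ ≤ K := by rw [hK]; linarith
  have hKC₁ : C₁ ≤ K := by rw [hK]; linarith
  have hKC₂ : C₂ ≤ K := by rw [hK]; linarith
  have ha0 : 0 ≤ D.a := D.a_pos.le
  have ha1 : D.a ≤ 1 := D.a_lt_one.le
  set κ : ℝ := 2 * π / D.per with hκ
  have hκ1 : 1 ≤ κ := by
    rw [hκ, le_div_iff₀ D.per_pos]; nlinarith [Real.pi_gt_three, D.per_le_two]
  refine ⟨40 * K * (Real.exp (κ * D.a) * (120 * Real.exp 2)) + |D.lam|, fun w hre hy => ?_⟩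
  have hy0 : 0 < w.im := by linarith
  set E : ℝ := Real.exp (-(2 * π / D.per) * (w.im - D.a)) with hE
  have hE0 : 0 ≤ E := (Real.exp_pos _).le
  have hP0 := h0 w hre hy
  have hP1 := h1 w hre hy
  have hP2 := h2 w hre hy
  rw [← hE] at hP0 hP1 hP2
  have hy2 : 1 ≤ 2 + w.im := by linarith
  set B : ℝ := K * (2 + w.im) ^ 2 * E with hB
  have hBnn : 0 ≤ B := by rw [hB]; positivity
  have hsq1 : (1:ℝ) ≤ (2 + w.im) ^ 2 := by exact one_le_pow₀ hy2
  have hsq2 : (2 + w.im) ≤ (2 + w.im) ^ 2 := by nlinarith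
  have hB0 : ‖D.Pk 0 (w - (D.a : ℂ) * Complex.I)‖ ≤ B := by
    refine hP0.trans ?_
    rw [hB, pow_zero]
    gcongr
  have hB1 : ‖D.Pk 1 (w - (D.a : ℂ) * Complex.I)‖ ≤ B := by
    refine hP1.trans ?_
    rw [hB, pow_one]
    gcongr
  have hB2 : ‖D.Pk 2 (w - (D.a : ℂ) * Complex.I)‖ ≤ B := by
    refine hP2.trans ?_
    rw [hB]
    gcongr
  have ha : ‖(D.a : ℂ) * Complex.I‖ = D.a := by simp [abs_of_pos D.a_pos]
  have hw : ‖w‖ ≤ 2 + w.im := by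
    calc ‖w‖ ≤ |w.re| + |w.im| := Complex.norm_le_abs_re_add_abs_im w
      _ ≤ 2 + w.im := by rw [abs_of_pos hy0]; linarith
  have hM0 : ‖D.M₀ w‖ ≤ B := hB0
  have hM1 : ‖D.M₁ w‖ ≤ 2 * B := by
    rw [M₁]
    calc ‖D.Pk 1 (w - (D.a:ℂ) * Complex.I) + (D.a:ℂ) * Complex.I * D.Pk 0 (w - (D.a:ℂ) * Complex.I)‖
        ≤ ‖D.Pk 1 (w - (D.a:ℂ) * Complex.I)‖ + ‖(D.a:ℂ) * Complex.I‖ * ‖D.Pk 0 (w - (D.a:ℂ) * Complex.I)‖ := by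
          refine (norm_add_le _ _).trans ?_; rw [norm_mul]
      _ ≤ B + D.a * B := by rw [ha]; gcongr
      _ ≤ 2 * B := by
          have h1 : D.a * B ≤ 1 * B := mul_le_mul_of_nonneg_right ha1 hBnn
          linarith
  have hM2 : ‖D.M₂ w‖ ≤ 4 * B := by
    rw [M₂]
    have e1 : ‖2 * ((D.a:ℂ) * Complex.I) * D.Pk 1 (w - (D.a:ℂ) * Complex.I)‖ =
        2 * D.a * ‖D.Pk 1 (w - (D.a:ℂ) * Complex.I)‖ := by
      rw [norm_mul, norm_mul, ha]; simp
    have e2 : ‖((D.a:ℂ) * Complex.I) ^ 2 * D.Pk 0 (w - (D.a:ℂ) * Complex.I)‖ =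
        D.a ^ 2 * ‖D.Pk 0 (w - (D.a:ℂ) * Complex.I)‖ := by
      rw [norm_mul, norm_pow, ha]
    calc ‖D.Pk 2 (w - (D.a:ℂ) * Complex.I) + 2 * ((D.a:ℂ) * Complex.I) * D.Pk 1 (w - (D.a:ℂ) * Complex.I) +
          ((D.a:ℂ) * Complex.I) ^ 2 * D.Pk 0 (w - (D.a:ℂ) * Complex.I)‖
        ≤ ‖D.Pk 2 (w - (D.a:ℂ) * Complex.I)‖ + ‖2 * ((D.a:ℂ) * Complex.I) * D.Pk 1 (w - (D.a:ℂ) * Complex.I)‖ +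
          ‖((D.a:ℂ) * Complex.I) ^ 2 * D.Pk 0 (w - (D.a:ℂ) * Complex.I)‖ := norm_add₃_le
      _ = ‖D.Pk 2 (w - (D.a:ℂ) * Complex.I)‖ + 2 * D.a * ‖D.Pk 1 (w - (D.a:ℂ) * Complex.I)‖ +
          D.a ^ 2 * ‖D.Pk 0 (w - (D.a:ℂ) * Complex.I)‖ := by rw [e1, e2]
      _ ≤ B + 2 * D.a * B + D.a ^ 2 * B := by gcongr
      _ ≤ 4 * B := by
          have h1 : D.a * B ≤ 1 * B := mul_le_mul_of_nonneg_right ha1 hBnn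
          have h2 : D.a ^ 2 * B ≤ 1 * B := mul_le_mul_of_nonneg_right (by nlinarith) hBnn
          linarith
  have hA1 : ‖D.A₁ w‖ ≤ 2 * B + (2 + w.im) * B := by
    rw [A₁]
    calc ‖D.M₁ w - w * D.M₀ w‖ ≤ ‖D.M₁ w‖ + ‖w * D.M₀ w‖ := norm_sub_le _ _
      _ = ‖D.M₁ w‖ + ‖w‖ * ‖D.M₀ w‖ := by rw [norm_mul]
      _ ≤ 2 * B + (2 + w.im) * B := by gcongr
  have hA2 : ‖D.A₂ w‖ ≤ 4 * B + 2 * (2 + w.im) * (2 * B) + (2 + w.im) ^ 2 * B := by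
    rw [A₂]
    calc ‖D.M₂ w - 2 * w * D.M₁ w + w ^ 2 * D.M₀ w‖
        ≤ ‖D.M₂ w‖ + ‖2 * w * D.M₁ w‖ + ‖w ^ 2 * D.M₀ w‖ := by
          refine (norm_add_le _ _).trans (add_le_add (norm_sub_le _ _) le_rfl)
      _ = ‖D.M₂ w‖ + 2 * ‖w‖ * ‖D.M₁ w‖ + ‖w‖ ^ 2 * ‖D.M₀ w‖ := by
          rw [norm_mul, norm_mul, norm_mul, norm_pow]; simp
      _ ≤ 4 * B + 2 * (2 + w.im) * (2 * B) + (2 + w.im) ^ 2 * B := by gcongr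
  have hF : |D.Fbase w| * w.im ≤ ‖D.A₂ w‖ + 2 * w.im * ‖D.A₁ w‖ + |D.lam| := by
    rw [Fbase]
    have e : ((D.A₂ w).im / w.im + 2 * (D.A₁ w).re + D.lam / w.im) * w.im =
        (D.A₂ w).im + 2 * w.im * (D.A₁ w).re + D.lam := by
      field_simp
    rw [← abs_of_pos hy0, ← abs_mul, abs_of_pos hy0, e]
    calc |(D.A₂ w).im + 2 * w.im * (D.A₁ w).re + D.lam|
        ≤ |(D.A₂ w).im| + |2 * w.im * (D.A₁ w).re| + |D.lam| := abs_add_three _ _ _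
      _ ≤ ‖D.A₂ w‖ + 2 * w.im * ‖D.A₁ w‖ + |D.lam| := by
          have h1 : |(D.A₂ w).im| ≤ ‖D.A₂ w‖ := Complex.abs_im_le_norm _
          have h2 : |2 * w.im * (D.A₁ w).re| ≤ 2 * w.im * ‖D.A₁ w‖ := by
            rw [abs_mul, abs_of_pos (by linarith : (0:ℝ) < 2 * w.im)]
            exact mul_le_mul_of_nonneg_left (Complex.abs_re_le_norm _) (by linarith)
          linarith
  have hpoly : ‖D.A₂ w‖ + 2 * w.im * ‖D.A₁ w‖ ≤ 40 * K * ((2 + w.im) ^ 5 * E) := by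
    have hBle : B ≤ K * ((2 + w.im) ^ 5 * E) := by
      rw [hB]
      calc K * (2 + w.im) ^ 2 * E = K * ((2 + w.im) ^ 2 * E) := by ring
        _ ≤ K * ((2 + w.im) ^ 5 * E) := by gcongr; norm_num
    have hB1le : (2 + w.im) * B ≤ K * ((2 + w.im) ^ 5 * E) := by
      rw [hB]
      calc (2 + w.im) * (K * (2 + w.im) ^ 2 * E) = K * ((2 + w.im) ^ 3 * E) := by ring
        _ ≤ K * ((2 + w.im) ^ 5 * E) := by gcongr; norm_num
    have hB2le : (2 + w.im) ^ 2 * B ≤ K * ((2 + w.im) ^ 5 * E) := by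
      rw [hB]
      calc (2 + w.im) ^ 2 * (K * (2 + w.im) ^ 2 * E) = K * ((2 + w.im) ^ 4 * E) := by ring
        _ ≤ K * ((2 + w.im) ^ 5 * E) := by gcongr; norm_num
    have hyB : 2 * w.im * ‖D.A₁ w‖ ≤ 2 * (2 + w.im) * (2 * B + (2 + w.im) * B) := by
      calc 2 * w.im * ‖D.A₁ w‖ ≤ 2 * (2 + w.im) * ‖D.A₁ w‖ := by gcongr; linarith
        _ ≤ 2 * (2 + w.im) * (2 * B + (2 + w.im) * B) := by gcongr
    have e1 : 2 * (2 + w.im) * (2 * B + (2 + w.im) * B) = 4 * ((2 + w.im) * B) + 2 * ((2 + w.im) ^ 2 * B) := by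
      ring
    have e2 : 4 * B + 2 * (2 + w.im) * (2 * B) + (2 + w.im) ^ 2 * B =
        4 * B + 4 * ((2 + w.im) * B) + (2 + w.im) ^ 2 * B := by ring
    rw [e1] at hyB
    rw [e2] at hA2
    have hKE : 0 ≤ K * ((2 + w.im) ^ 5 * E) := by positivity
    linarith [hA2, hyB, hBle, hB1le, hB2le, hKE]
  have hexp : (2 + w.im) ^ 5 * E ≤ Real.exp (κ * D.a) * (120 * Real.exp 2) := by
    have h1 : E = Real.exp (κ * D.a) * Real.exp (-κ * w.im) := by
      rw [hE, ← Real.exp_add, hκ]; ring_nf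
    have h2 : Real.exp (-κ * w.im) ≤ Real.exp 2 * Real.exp (-(2 + w.im)) := by
      rw [← Real.exp_add]; apply Real.exp_le_exp.mpr; nlinarith
    have h3 := GreenRho.pow_five_mul_exp_neg_le (show (0:ℝ) ≤ 2 + w.im by linarith)
    have hp : 0 ≤ (2 + w.im) ^ 5 := by positivity
    calc (2 + w.im) ^ 5 * E = Real.exp (κ * D.a) * ((2 + w.im) ^ 5 * Real.exp (-κ * w.im)) := by
          rw [h1]; ring
      _ ≤ Real.exp (κ * D.a) * ((2 + w.im) ^ 5 * (Real.exp 2 * Real.exp (-(2 + w.im)))) := by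
          gcongr
      _ = Real.exp (κ * D.a) * (Real.exp 2 * ((2 + w.im) ^ 5 * Real.exp (-(2 + w.im)))) := by ring
      _ ≤ Real.exp (κ * D.a) * (Real.exp 2 * 120) := by gcongr
      _ = _ := by ring
  have hfin : 40 * K * ((2 + w.im) ^ 5 * E) ≤ 40 * K * (Real.exp (κ * D.a) * (120 * Real.exp 2)) := by
    gcongr
  linarith [hF, hpoly, hfin]

/-- The cusp bound after an integer-period translation into `|Re| ≤ per/2 ≤ 1`. [folklore] -/
theorem exists_Fbase_cusp_bound' :
    ∃ C : ℝ, ∀ w : ℂ, 2 ≤ w.im → |D.Fbase w| * w.im ≤ C := by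
  obtain ⟨C, hC⟩ := D.exists_Fbase_cusp_bound
  refine ⟨C, fun w hy => ?_⟩
  have hp := D.per_pos
  set n : ℤ := -⌊w.re / D.per + 1 / 2⌋ with hn
  have h1 : ((⌊w.re / D.per + 1 / 2⌋ : ℤ) : ℝ) ≤ w.re / D.per + 1 / 2 := Int.floor_le _
  have h2 : w.re / D.per + 1 / 2 < ((⌊w.re / D.per + 1 / 2⌋ : ℤ) : ℝ) + 1 := Int.lt_floor_add_one _
  have hre : |(w + n * D.per).re| ≤ 1 := by
    have e : (w + n * D.per).re = w.re + n * D.per := by simp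
    rw [e, hn, abs_le]
    push_cast
    have hq : w.re = (w.re / D.per) * D.per := by field_simp
    constructor <;> nlinarith [D.per_le_two]
  have him : (w + n * D.per).im = w.im := by simp
  have hw : D.a < w.im := by linarith [D.a_lt_one]
  have := hC (w + n * D.per) hre (by rw [him]; exact hy)
  rwa [him, D.Fbase_add_int_mul_per hw] at this

/-! ## 6. The logarithmic singularity from a local expansion -/

/-- **Logarithmic asymptotics.** If `g = α(ζ−p)⁻² + b(ζ−p)⁻¹ + h(ζ)` near a point `p` of height
`a` (`h` continuous at `p`), then near `p` in `Im > a`: `A₁(u) = −α log(u − p) + O(1)` and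
`A₂(u) = O(1)`. [folklore] -/
theorem A₁_A₂_near {p : ℂ} (hp : p.im = D.a) {α b : ℂ} {h : ℂ → ℂ} (hcont : ContinuousAt h p)
    (hexp : ∀ᶠ ζ in 𝓝 p, ζ ≠ p → 0 < ζ.im → D.gC ζ = α / (ζ - p) ^ 2 + b / (ζ - p) + h ζ) :
    ∃ K ε : ℝ, 0 < ε ∧ ∀ u : ℂ, ‖u - p‖ < ε → D.a < u.im →
      ‖D.A₁ u + α * Complex.log (u - p)‖ ≤ K ∧ ‖D.A₂ u‖ ≤ K := by
  have hbd : ∀ᶠ ζ in 𝓝 p, ‖h ζ‖ < ‖h p‖ + 1 := by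
    have := hcont.norm
    exact this.eventually (gt_mem_nhds (by linarith))
  obtain ⟨ε₀, hε₀, hball⟩ := Metric.eventually_nhds_iff_ball.mp (hexp.and hbd)
  set ε : ℝ := min (ε₀ / 2) (1 / 2) with hεdef
  have hε : 0 < ε := by rw [hεdef]; positivity
  have hεle : ε ≤ ε₀ / 2 := min_le_left _ _
  have hε1 : ε ≤ 1 / 2 := min_le_right _ _
  set V : Set ℂ := {u : ℂ | ‖u - p‖ < ε ∧ D.a < u.im} with hV
  have hVconv : Convex ℝ V := by
    have : V = Metric.ball p ε ∩ {u : ℂ | D.a < u.im} := by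
      ext u; simp [hV, dist_eq_norm]
    rw [this]
    exact (convex_ball _ _).inter (convex_halfSpace_gt Complex.imLm.isLinear D.a)
  have hVball : ∀ u ∈ V, u ∈ Metric.ball p ε₀ := fun u hu => by
    rw [Metric.mem_ball, dist_eq_norm]; linarith [hu.1]
  have hVne : ∀ u ∈ V, u ≠ p := fun u hu h0 => by
    have := hu.2; rw [h0, hp] at this; exact lt_irrefl _ this
  have hVpos : ∀ u ∈ V, 0 < u.im := fun u hu => D.a_pos.trans hu.2
  have hVslit : ∀ u ∈ V, u - p ∈ Complex.slitPlane := fun u hu => by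
    rw [Complex.mem_slitPlane_iff]; right
    have : (u - p).im = u.im - D.a := by simp [hp]
    rw [this]; linarith [hu.2]
  set u₁ : ℂ := p + (ε / 2 : ℝ) * Complex.I with hu₁def
  have hu₁ : u₁ ∈ V := by
    refine ⟨?_, ?_⟩
    · rw [hu₁def, add_sub_cancel_left, norm_mul, Complex.norm_real, Complex.norm_I, mul_one,
        Real.norm_eq_abs, abs_of_pos (by positivity)]
      linarith
    · rw [hu₁def]; simp [hp]; positivity
  have hdist : ∀ u ∈ V, ‖u - u₁‖ ≤ 2 * ε := fun u hu => by
    calc ‖u - u₁‖ = ‖(u - p) - (u₁ - p)‖ := by ring_nf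
      _ ≤ ‖u - p‖ + ‖u₁ - p‖ := norm_sub_le _ _
      _ ≤ ε + ε := by gcongr <;> [exact hu.1.le; exact hu₁.1.le]
      _ = 2 * ε := by ring
  have hfexp : ∀ u ∈ V, D.gC u = α / (u - p) ^ 2 + b / (u - p) + h u := fun u hu =>
    (hball u (hVball u hu)).1 (hVne u hu) (hVpos u hu)
  have hhb : ∀ u ∈ V, ‖h u‖ ≤ ‖h p‖ + 1 := fun u hu => ((hball u (hVball u hu)).2).le
  -- Step 0
  set R₀ : ℂ → ℂ := fun u => D.M₀ u - α / (u - p) + b * Complex.log (u - p) with hR₀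
  have hR₀d : ∀ u ∈ V, HasDerivAt R₀ (-h u) u := by
    intro u hu
    have hsub : u - p ≠ 0 := sub_ne_zero.mpr (hVne u hu)
    have h1 := D.hasDerivAt_M₀ hu.2
    have h2 : HasDerivAt (fun u => α / (u - p)) (-α / (u - p) ^ 2) u := by
      have := ((hasDerivAt_id u).sub_const p).inv hsub
      have := this.const_mul α
      refine (this.congr_of_eventuallyEq (Eventually.of_forall fun v => by simp [div_eq_mul_inv])).congr_deriv ?_
      simp; ring
    have h3 : HasDerivAt (fun u => b * Complex.log (u - p)) (b * (u - p)⁻¹) u := by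
      have := ((Complex.hasDerivAt_log (hVslit u hu)).comp u ((hasDerivAt_id u).sub_const p))
      simpa using this.const_mul b
    have := (h1.sub h2).add h3
    refine (this.congr_of_eventuallyEq (Eventually.of_forall fun v => rfl)).congr_deriv ?_
    rw [hfexp u hu]
    field_simp
    ring
  have hR₀b := GreenRho.bounded_of_deriv_bounded (K := ‖h p‖ + 1) hVconv hu₁ hdist hR₀d
    (fun u hu => by rw [norm_neg]; exact hhb u hu)
  set K₀ : ℝ := ‖R₀ u₁‖ + (‖h p‖ + 1) * (2 * ε) with hK₀
  -- Step 1
  set Λ : ℂ → ℂ := fun u => (u - p) * Complex.log (u - p) - (u - p) with hΛ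
  have hΛd : ∀ u ∈ V, HasDerivAt Λ (Complex.log (u - p)) u := by
    intro u hu
    have hsub : u - p ≠ 0 := sub_ne_zero.mpr (hVne u hu)
    have hl := (Complex.hasDerivAt_log (hVslit u hu)).comp u ((hasDerivAt_id u).sub_const p)
    have h1 := ((hasDerivAt_id u).sub_const p).mul hl
    have := h1.sub ((hasDerivAt_id u).sub_const p)
    refine (this.congr_of_eventuallyEq (Eventually.of_forall fun v => rfl)).congr_deriv ?_
    simp only [Function.comp_apply, id]
    field_simp
    ring
  have hΛb : ∀ u ∈ V, ‖Λ u‖ ≤ 2 + π := by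
    intro u hu
    have hv0 : ‖u - p‖ < ε := hu.1
    have hv1 : ‖u - p‖ ≤ 1 := by linarith
    calc ‖Λ u‖ ≤ ‖(u - p) * Complex.log (u - p)‖ + ‖u - p‖ := norm_sub_le _ _
      _ ≤ (1 + π) + 1 := by gcongr; exact GreenRho.norm_mul_log_le hv1
      _ = 2 + π := by ring
  set R₁ : ℂ → ℂ := fun u => D.A₁ u + α * Complex.log (u - p) - b * Λ u with hR₁
  have hR₁d : ∀ u ∈ V, HasDerivAt R₁ (-R₀ u) u := by
    intro u hu
    have hsub : u - p ≠ 0 := sub_ne_zero.mpr (hVne u hu)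
    have h1 := D.hasDerivAt_A₁ hu.2
    have h2 : HasDerivAt (fun u => α * Complex.log (u - p)) (α * (u - p)⁻¹) u := by
      have := ((Complex.hasDerivAt_log (hVslit u hu)).comp u ((hasDerivAt_id u).sub_const p))
      simpa using this.const_mul α
    have h3 := (hΛd u hu).const_mul b
    have := (h1.add h2).sub h3
    refine (this.congr_of_eventuallyEq (Eventually.of_forall fun v => rfl)).congr_deriv ?_
    simp only [hR₀]
    field_simp
    ring
  have hR₁b := GreenRho.bounded_of_deriv_bounded (K := ‖R₀ u₁‖ + (‖h p‖ + 1) * (2 * ε)) hVconv hu₁ hdist hR₁d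
    (fun u hu => by rw [norm_neg]; exact hR₀b u hu)
  set K₁ : ℝ := ‖R₁ u₁‖ + K₀ * (2 * ε) with hK₁
  have hA1b : ∀ u ∈ V, ‖D.A₁ u + α * Complex.log (u - p)‖ ≤ K₁ + ‖b‖ * (2 + π) := by
    intro u hu
    have e : D.A₁ u + α * Complex.log (u - p) = R₁ u + b * Λ u := by simp only [hR₁]; ring
    rw [e]
    calc ‖R₁ u + b * Λ u‖ ≤ ‖R₁ u‖ + ‖b‖ * ‖Λ u‖ := by
          refine (norm_add_le _ _).trans ?_; rw [norm_mul]
      _ ≤ K₁ + ‖b‖ * (2 + π) := by gcongr <;> [exact hR₁b u hu; exact hΛb u hu]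
  -- Step 2
  set R₂ : ℂ → ℂ := fun u => D.A₂ u - 2 * α * Λ u with hR₂
  have hR₂d : ∀ u ∈ V, HasDerivAt R₂ (-(2 * (D.A₁ u + α * Complex.log (u - p)))) u := by
    intro u hu
    have h1 := D.hasDerivAt_A₂ hu.2
    have h2 := (hΛd u hu).const_mul (2 * α)
    have := h1.sub h2
    refine (this.congr_of_eventuallyEq (Eventually.of_forall fun v => rfl)).congr_deriv ?_
    ring
  have hR₂b := GreenRho.bounded_of_deriv_bounded (K := 2 * (K₁ + ‖b‖ * (2 + π))) hVconv hu₁ hdist hR₂d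
    (fun u hu => by rw [norm_neg, norm_mul, Complex.norm_two]; linarith [hA1b u hu])
  refine ⟨max (K₁ + ‖b‖ * (2 + π)) (‖R₂ u₁‖ + 2 * (K₁ + ‖b‖ * (2 + π)) * (2 * ε) + 2 * ‖α‖ * (2 + π)),
    ε, hε, fun u hu1 hu2 => ?_⟩
  have hu : u ∈ V := ⟨hu1, hu2⟩
  refine ⟨(hA1b u hu).trans (le_max_left _ _), le_trans ?_ (le_max_right _ _)⟩
  have e : D.A₂ u = R₂ u + 2 * α * Λ u := by simp only [hR₂]; ring
  rw [e]
  calc ‖R₂ u + 2 * α * Λ u‖ ≤ ‖R₂ u‖ + 2 * ‖α‖ * ‖Λ u‖ := by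
        refine (norm_add_le _ _).trans ?_
        rw [norm_mul, norm_mul, Complex.norm_two]
    _ ≤ ‖R₂ u₁‖ + 2 * (K₁ + ‖b‖ * (2 + π)) * (2 * ε) + 2 * ‖α‖ * (2 + π) := by
        have ha2 : 0 ≤ 2 * ‖α‖ := by positivity
        gcongr
        · exact hR₂b u hu
        · exact hΛb u hu

/-- **`Fbase` near the pole**: under the local expansion of `A₁_A₂_near` with a REAL leading
coefficient `α`, `Fbase(u) = −2α log‖u − p‖ + O(1)` on `Im u > a`. [folklore] -/
theorem Fbase_log_bound {p : ℂ} (hp : p.im = D.a) {α : ℝ} {b : ℂ} {h : ℂ → ℂ} (hcont : ContinuousAt h p)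
    (hexp : ∀ᶠ ζ in 𝓝 p, ζ ≠ p → 0 < ζ.im → D.gC ζ = (α : ℂ) / (ζ - p) ^ 2 + b / (ζ - p) + h ζ) :
    ∃ K ε : ℝ, 0 < ε ∧ ∀ u : ℂ, ‖u - p‖ < ε → D.a < u.im →
      |D.Fbase u + 2 * α * Real.log ‖u - p‖| ≤ K := by
  obtain ⟨K, ε, hε, hK⟩ := D.A₁_A₂_near hp hcont hexp
  refine ⟨K / D.a + 2 * K + |D.lam| / D.a, ε, hε, fun u hu1 hu2 => ?_⟩
  obtain ⟨h1, h2⟩ := hK u hu1 hu2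
  have hy : 0 < u.im := D.a_pos.trans hu2
  rw [Fbase]
  have hre : |(D.A₁ u).re + α * Real.log ‖u - p‖| ≤ K := by
    have e : (D.A₁ u).re + α * Real.log ‖u - p‖ = (D.A₁ u + α * Complex.log (u - p)).re := by
      simp [Complex.log_re]
    rw [e]; exact (Complex.abs_re_le_norm _).trans h1
  have him : |(D.A₂ u).im| ≤ K := (Complex.abs_im_le_norm _).trans h2
  have hK0 : 0 ≤ K := (norm_nonneg _).trans h2
  have hdiv1 : |(D.A₂ u).im / u.im| ≤ K / D.a := by
    rw [abs_div, abs_of_pos hy]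
    calc |(D.A₂ u).im| / u.im ≤ K / u.im := by gcongr
      _ ≤ K / D.a := div_le_div_of_nonneg_left hK0 D.a_pos hu2.le
  have hdiv2 : |D.lam / u.im| ≤ |D.lam| / D.a := by
    rw [abs_div, abs_of_pos hy]
    exact div_le_div_of_nonneg_left (abs_nonneg _) D.a_pos hu2.le
  have e : (D.A₂ u).im / u.im + 2 * (D.A₁ u).re + D.lam / u.im + 2 * α * Real.log ‖u - p‖ =
      (D.A₂ u).im / u.im + 2 * ((D.A₁ u).re + α * Real.log ‖u - p‖) + D.lam / u.im := by ring
  rw [e]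
  calc |(D.A₂ u).im / u.im + 2 * ((D.A₁ u).re + α * Real.log ‖u - p‖) + D.lam / u.im|
      ≤ |(D.A₂ u).im / u.im| + |2 * ((D.A₁ u).re + α * Real.log ‖u - p‖)| + |D.lam / u.im| := abs_add_three _ _ _
    _ ≤ K / D.a + 2 * K + |D.lam| / D.a := by
        rw [abs_mul, abs_two]
        gcongr

/-! ## 8. The value at `i` -/

/-- `Fbase(i) = 2 Im M₀(i)`. [folklore] -/
theorem Fbase_I : D.Fbase Complex.I = 2 * (D.M₀ Complex.I).im := by
  rw [Fbase, lam, c₀_eq, c₂, A₂, A₁, Complex.I_sq]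
  simp only [Complex.I_im, div_one, Complex.neg_im, Complex.sub_im, Complex.add_im, Complex.mul_im,
    Complex.mul_re, Complex.I_re, Complex.sub_re, zero_mul, one_mul, mul_one, mul_zero, sub_zero,
    zero_add, add_zero, Complex.re_ofNat, Complex.im_ofNat, Complex.neg_re, Complex.one_re,
    Complex.one_im, neg_zero]
  ring

/-- Points of the shifted axis: `φ(ofComplex((1 − a)i + u i)) = g(EllipticCurves.ModularForms.axisPt (1 + u))`. [folklore] -/
theorem φ_ofComplex_axis {u : ℝ} (hu : 0 < u) :
    D.φ (ofComplex (Complex.I - (D.a : ℂ) * Complex.I + u * Complex.I)) = D.g (EllipticCurves.ModularForms.axisPt (1 + u)) := by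
  have him : D.a < (Complex.I + (u : ℂ) * Complex.I).im := by simp; linarith [D.a_lt_one]
  have := D.φ_ofComplex_sub him
  rw [show Complex.I + (u : ℂ) * Complex.I - (D.a : ℂ) * Complex.I =
    Complex.I - (D.a : ℂ) * Complex.I + u * Complex.I by ring] at this
  rw [this, EllipticCurves.ModularForms.axisPt]
  congr 2
  push_cast; ring

/-- `M₀(i) = i ∫_{t>1} g(it) dt`. [folklore] -/
theorem M₀_I : D.M₀ Complex.I = Complex.I * ∫ t in Ioi (1 : ℝ), D.g (EllipticCurves.ModularForms.axisPt t) := by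
  rw [M₀, Pk, powPrimitive_zero]
  have hpos : 0 < (Complex.I - (D.a : ℂ) * Complex.I).im := by simp; exact D.a_lt_one
  rw [eichlerPrimitive, ofComplex_apply_of_im_pos hpos]
  congr 1
  rw [setIntegral_congr_fun measurableSet_Ioi (fun t (ht : t ∈ Ioi (0:ℝ)) => D.φ_ofComplex_axis ht)]
  have h1 : ∫ t in Ioi (0 : ℝ), D.g (EllipticCurves.ModularForms.axisPt (1 + t)) =
      ∫ t, (Ioi (1 : ℝ)).indicator (fun s => D.g (EllipticCurves.ModularForms.axisPt s)) (t + 1) := by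
    rw [← integral_indicator measurableSet_Ioi]
    congr 1; funext t
    simp only [Set.indicator]
    have : t ∈ Ioi (0 : ℝ) ↔ t + 1 ∈ Ioi (1 : ℝ) := by simp
    by_cases ht : t ∈ Ioi (0 : ℝ)
    · rw [if_pos ht, if_pos (this.mp ht), add_comm]
    · rw [if_neg ht, if_neg (fun h => ht (this.mpr h))]
  rw [h1, MeasureTheory.integral_add_right_eq_self, integral_indicator measurableSet_Ioi]

/-- **`Im M₁(i) = 0` when `g` is real on the imaginary axis.** [folklore] -/
theorem M₁_I_im_eq_zero {r : ℝ → ℝ} (hr : ∀ t : ℝ, 0 < t → D.g (EllipticCurves.ModularForms.axisPt t) = (r t : ℂ)) :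
    (D.M₁ Complex.I).im = 0 := by
  have hpos : 0 < (Complex.I - (D.a : ℂ) * Complex.I).im := by simp; exact D.a_lt_one
  set τ₀ : ℂ := Complex.I - (D.a : ℂ) * Complex.I with hτ₀
  have hE : eichlerPrimitive D.φ (ofComplex τ₀) = D.M₀ Complex.I := by rw [M₀, Pk, powPrimitive_zero]
  have hM1 : D.M₁ Complex.I = Complex.I * D.M₀ Complex.I +
      eichlerPrimitive (eichlerPrimitive D.φ) (ofComplex τ₀) := by
    rw [M₁, Pk, Pk, powPrimitive_succ, powPrimitive_zero, powPrimitive_zero, hE,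
      ofComplex_apply_of_im_pos hpos]
    change (τ₀) ^ 1 * D.M₀ Complex.I + _ + _ = _
    push_cast; ring
  have hM0 : D.M₀ Complex.I = Complex.I * ((∫ t in Ioi (1 : ℝ), r t : ℝ) : ℂ) := by
    rw [M₀_I, ← integral_complex_ofReal]
    congr 1
    exact setIntegral_congr_fun measurableSet_Ioi fun t ht => hr t (zero_lt_one.trans ht)
  have hinner : ∀ t : ℝ, 0 < t → eichlerPrimitive D.φ (ofComplex (τ₀ + t * Complex.I)) =
      Complex.I * ((∫ s in Ioi (0 : ℝ), r (1 + t + s) : ℝ) : ℂ) := by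
    intro t ht
    have hpos' : 0 < (τ₀ + t * Complex.I).im := by rw [hτ₀]; simp; linarith [D.a_lt_one]
    rw [eichlerPrimitive, ofComplex_apply_of_im_pos hpos', ← integral_complex_ofReal]
    congr 1
    refine setIntegral_congr_fun measurableSet_Ioi fun s hs => ?_
    change D.φ (ofComplex (τ₀ + (t : ℂ) * Complex.I + (s : ℂ) * Complex.I)) = _
    have hts : 0 < t + s := add_pos ht hs
    have := D.φ_ofComplex_axis hts
    rw [hτ₀, show Complex.I - (D.a : ℂ) * Complex.I + (t : ℂ) * Complex.I + (s : ℂ) * Complex.I =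
      Complex.I - (D.a : ℂ) * Complex.I + ((t + s : ℝ) : ℂ) * Complex.I by push_cast; ring, this,
      hr _ (by linarith), show 1 + (t + s) = 1 + t + s by ring]
  have hE2 : eichlerPrimitive (eichlerPrimitive D.φ) (ofComplex τ₀) =
      -((∫ t in Ioi (0 : ℝ), ∫ s in Ioi (0 : ℝ), r (1 + t + s) : ℝ) : ℂ) := by
    rw [eichlerPrimitive, ofComplex_apply_of_im_pos hpos]
    change Complex.I * ∫ t in Ioi (0 : ℝ), eichlerPrimitive D.φ (ofComplex (τ₀ + t * Complex.I)) = _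
    rw [setIntegral_congr_fun measurableSet_Ioi fun t (ht : t ∈ Ioi (0 : ℝ)) => hinner t ht,
      integral_const_mul, integral_complex_ofReal, ← mul_assoc, Complex.I_mul_I]
    ring
  rw [hM1, hM0, hE2, ← mul_assoc, Complex.I_mul_I]
  simp

end HeckeFormData

/-! ## 7. Matching with `higherGreen N 2 1` through uniqueness -/

/-- **Matching principle.** Let `F` be `IsResolventGreenLike N 2 z'` with
`F(z) = −2α log‖z − z'‖ + O(1)` near `z'` off the orbit (`α ≠ 0`). Then off the orbit
`higherGreen N 2 1 z z' = (−n/α)·F(z)` with `n = #Stab_{Γ₀(N)}(z')`. [cite: GrossZagier1986, §II.2] -/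
theorem higherGreen_eq_neg_card_div_mul {N : ℕ} (hN : 0 < N) {z' : ℍ} {F : ℍ → ℝ}
    (hF : IsResolventGreenLike N 2 z' F) {α : ℝ} (hα : α ≠ 0)
    (hlog : ∃ C ε : ℝ, 0 < ε ∧ ∀ z : ℍ, z ∉ MulAction.orbit (CongruenceSubgroup.Gamma0 N) z' →
      ‖(z : ℂ) - z'‖ < ε → |F z + 2 * α * Real.log ‖(z : ℂ) - z'‖| ≤ C)
    (z : ℍ) (hz : z ∉ MulAction.orbit (CongruenceSubgroup.Gamma0 N) z') :
    higherGreen N 2 1 z z' =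
      (-(Nat.card (MulAction.stabilizer (CongruenceSubgroup.Gamma0 N) z') : ℝ) / α) * F z := by
  set n : ℝ := (Nat.card (MulAction.stabilizer (CongruenceSubgroup.Gamma0 N) z') : ℝ) with hn
  set C₀ : ℝ := -n / α with hC₀
  obtain ⟨hG, CG, εG, hεG, hGsing⟩ := higherGreen_isResolventGreenLike_holds N 2 hN le_rfl z'
  have hF' : IsResolventGreenLike N 2 z' (fun z => C₀ * F z) := hF.const_mul C₀
  obtain ⟨CF, εF, hεF, hFsing⟩ := hlog
  have hc : ContinuousAt (fun z : ℍ => (z : ℂ)) z' := UpperHalfPlane.continuous_coe.continuousAt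
  obtain ⟨δ, hδ, hδε⟩ := Metric.continuousAt_iff.mp hc εF hεF
  symm
  refine resolventGreen_unique_holds N 2 hN le_rfl z' (fun z => C₀ * F z)
    (fun z => higherGreen N 2 1 z z') hF' hG ⟨|C₀| * CF + CG, min δ εG, lt_min hδ hεG, ?_⟩ z hz
  intro w hw hwo
  have hw1 : dist w z' < δ := lt_of_lt_of_le hw (min_le_left _ _)
  have hw2 : dist w z' < εG := lt_of_lt_of_le hw (min_le_right _ _)
  have hwne : w ≠ z' := fun h => hwo (h ▸ MulAction.mem_orbit_self _)
  have hnorm : ‖(w : ℂ) - z'‖ < εF := by simpa [dist_eq_norm] using hδε hw1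
  have h1 := hFsing w hwo hnorm
  have h2 := hGsing w hw2 hwne
  have hdist : dist (w : ℂ) (z' : ℂ) = ‖(w : ℂ) - z'‖ := by rw [dist_eq_norm]
  rw [hdist] at h2
  rw [Real.log_pow] at h2
  have h2' : |higherGreen N 2 1 w z' - n * (2 * Real.log ‖(w : ℂ) - z'‖)| ≤ CG := by
    simpa [hn] using h2
  have hCα : C₀ * (2 * α) = -(2 * n) := by
    rw [hC₀]; field_simp
  have e : C₀ * F w - higherGreen N 2 1 w z' =
      C₀ * (F w + 2 * α * Real.log ‖(w : ℂ) - z'‖) -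
        (higherGreen N 2 1 w z' - n * (2 * Real.log ‖(w : ℂ) - z'‖)) := by
    linear_combination -(Real.log ‖(w : ℂ) - z'‖) * hCα
  rw [e]
  calc |C₀ * (F w + 2 * α * Real.log ‖(w : ℂ) - z'‖) -
        (higherGreen N 2 1 w z' - n * (2 * Real.log ‖(w : ℂ) - z'‖))|
      ≤ |C₀ * (F w + 2 * α * Real.log ‖(w : ℂ) - z'‖)| +
        |higherGreen N 2 1 w z' - n * (2 * Real.log ‖(w : ℂ) - z'‖)| := abs_sub _ _
    _ ≤ |C₀| * CF + CG := by
        rw [abs_mul]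
        gcongr

end Literature.NumberTheory.Automorphic

end
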